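import Summits.HubbardSuperconductivity.HubbardSuperconductivity.Theorems.BalabanIRBirBdGPhaseCoercivity
import Summits.HubbardSuperconductivity.HubbardSuperconductivity.Theses.BalabanIR

/-!
# Line `bcs-dual-persistence` (reshaped, `V := K`) — FINAL skeleton for crux `BalabanIR.BirBdGPhaseCoercivity`
# (item stmt-HubbardSuperconductivity-2081): every stub landed, the closer landed, no `sorry` anywhere

Lead prover-line-stmt-HubbardSuperconductivity-2081-0, 2026-08-16. The v1 skeleton (this path, earlier commit /
evidence `line-bcs-dual-persistence-skeleton.lean`) registered seven stubs; all are tree theorems now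
(namespace `Summit.HubbardSuperconductivity.HubbardSuperconductivity.Theorems.BirBdGPhaseCoercivity`):
S1 `stub_negProj` (…Theorems/BalabanIRBirBdGPhaseCoercivityNegProj.lean, p86643), S2 `stub_bachBlock` (…BachBlock.lean,
p86832), S3 `stub_refTraceNorm` (…RefTraceNorm.lean, p86663), S4 `stub_sumAbsEig_hat` (…SumAbsEigHat.lean, p86602),
S5 `stub_pairModes` (…PairModes.lean, p86547), S6 `stub_defectBound` (…DefectBound.lean, p86649), S7 `stub_imSquareSum`
(…ImSquareSum.lean, p87184); the composed sub-goal `pairSymbolIneq` (…PairSymbol.lean, p88636); and the CLOSER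
`birBdGPhaseCoercivity_proof` (…Theorems/BalabanIRBirBdGPhaseCoercivity.lean — the item's body verbatim, Theses-free):
for every `μ ∈ (-4,4)`, `Δ₁ ≠ 0`, `Δ₂ ≠ 0`, with `c₀ = Δ₁²Δ₂²/(Δ_max²E_max)`, `Δ_max = 4(|Δ₁|+|Δ₂|)`,
`E_max = 4+|μ|+Δ_max`, `L₀ = 5`: `c₀ Σ_x Σ_{y∼x}(1 - cos(θ_x - θ_y)) ≤ Σ|λ(Hb(0))| - Σ|λ(Hb(θ))|` for all `L ≥ 5`, all `θ`.
Mechanism: Legendre duality of the BCS functional with Bach's two-quasiparticle kernel as auxiliary interaction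
(gap equation and stability become identities) ⇒ pair-fluctuation bound ⇒ exact-defect pair symbol ⇒ parameter-free
trigonometric sum. This file only records the by-name conclusion.
-/

namespace Summit.HubbardSuperconductivity.HubbardSuperconductivity.Cruxes.BirBdGPhaseCoercivity.BcsDualPersistence

/-- **The crux BY NAME** from the landed closer. -/
theorem BirBdGPhaseCoercivity_of :
    Summit.HubbardSuperconductivity.HubbardSuperconductivity.Theses.BalabanIR.BirBdGPhaseCoercivity :=
  Summit.HubbardSuperconductivity.HubbardSuperconductivity.Theorems.BirBdGPhaseCoercivity.birBdGPhaseCoercivity_proof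

end Summit.HubbardSuperconductivity.HubbardSuperconductivity.Cruxes.BirBdGPhaseCoercivity.BcsDualPersistence
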